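import Summits.BirchSwinnertonDyer.Rank1Residual.GaloisImage.CongruenceVisibilityTwistedWitnessDischarge
import Literature.NumberTheory.EllipticCurves.WeilPairingProofs
import HarnessLib

/-!
# Criterion (d) "twisted divisibility": the binder `E[p](M) = E[p](K_v)` from roots of unity
# (cell `b2b-bsdres`, team n1011, seat p10 GEN 8; row T-VIS3-UC, FILE 3; note
# `HOME/b2b-bsdres-n1011-p10/g8/L41-NOTE.md` §3, skeleton `cells/n1011/skel/T-VIS3-UC.md`)

HONEST FRAMING (cell `b2b-bsdres`, run/shared/lean/b2b/bsd-rank1-residual/, verbatim in every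
file): the goal of the cell is to DELETE the COMBINATION-SHAPED residual classes of the
Birch–Swinnerton-Dyer formula for ALL analytic-rank `≤ 1` elliptic curves over `ℚ` — "full BSD
formula for every rank `≤ 1` curve in class `C`" assembled STRICTLY from published theorems — so
that the rank-`≤ 1` remainder becomes exactly the CONSTRUCTION-SHAPED classes, which are TYPED
(missing-input `Prop`s), NOT attempted. This is not "finishing BSD". Team n1011 (N10 / N11):
research route on the CONSTRUCTION-SHAPED class X4 (§I N11 LOWER half); no claim beyond the stated
classes; nothing is booked; marks UNCHANGED. Theorems only: no definition, no named fact, no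
`sorry`. TOOL theorems; they close nothing by themselves.

## What

FILE 1's criterion (d) carries, for EACH of the two curves, the binder "every `p`-torsion point of
`E(K̄_v)` fixed by `H` is fixed by `Γ_{K_v}`" (`E[p](M) = E[p](K_v)` for `M = K̄_v^H`). This file
replaces both binders by ONE statement about the field `M` alone:

**`smul_eq_of_torsion_of_fixed_of_rootsOfUnity`**: let `H ⊴ Γ = Γ_E` with `Γ` generated over `H`
by `F` and `F ^ p ∈ H` (`[Γ : H] = p`), `p` prime, and suppose NO primitive `p`-th root of unity of
`K̄_E` is fixed by `H` (`μ_p(M) = 1`). Then every `p`-torsion point of `E(K̄_E)` fixed by `H` is fixed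
by `Γ`. Proof: if `T` is `H`-fixed `p`-torsion with `F T ≠ T`, put `D = F T − T ≠ 0` (again
`H`-fixed `p`-torsion, `H` normal). EITHER `D = c • T`: then `F` acts on `T` by the integer
`a = 1 + c` and `F^p T = a^p • T = a • T` (Fermat in `ℤ/p`, `p • T = 0`), contradicting
`F ^ p ∈ H`; OR `D ∉ ℤ • T`: then the `H`-fixed `p`-torsion is a subgroup of `E(K̄_E)[p]` (order
`p²`, Silverman III.6.4) of order `> p`, hence ALL of `E[p]` is `H`-fixed, and the Weil pairing
(tree `exists_weilPairing_holds`: bilinear, alternating, non-degenerate, Galois-equivariant —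
Silverman III.8.1) produces a primitive `p`-th root of unity `e_p(S, T)` fixed by `H` — excluded.
At `p = 3`, `K_v = ℚ₃`, `M = ℚ₃(α)`, `α³ = α + 1` (unramified cubic): `ζ₃ ∉ M` because
`[ℚ₃(ζ₃) : ℚ₃] = 2 ∤ 3` — a statement about `M` only, the same for every curve.

* §1 Fermat step and the two-generator step (any group acting on any abelian group / on `E(K̄_E)`).
* §2 the theorem, and FILE 1's §4 certificate shape with `hfixW`, `hfixW'` so discharged
  (`exists_sha_ne_zero_of_congr_of_twistedDivisible_of_rootsOfUnity`).

References: [SilvermanAEC2009] III.6.4, III.8.1 (Weil pairing), VIII.§1; the tree's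
`Literature/NumberTheory/EllipticCurves/WeilPairingProofs.lean`.
-/

noncomputable section

open scoped Classical

namespace Summit.BirchSwinnertonDyer.Rank1Residual.GaloisImage.TwistedWitness

open WeierstrassCurve Literature.NumberTheory.EllipticCurves Literature.NumberTheory.GaloisRepresentations
open Field

/-! ## §1 Two elementary steps -/

section Steps

variable {Γ A : Type*} [Group Γ] [AddCommGroup A] [DistribMulAction Γ A]

/-- If `F • T = a • T` for an integer `a` (and the action commutes with integer multiples), then
`F ^ k • T = a ^ k • T`. [folklore] -/
theorem pow_smul_eq_pow_zsmul (hcomm : ∀ (g : Γ) (m : ℤ) (X : A), g • (m • X) = m • (g • X))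
    {F : Γ} {T : A} {a : ℤ} (h : F • T = a • T) (k : ℕ) : F ^ k • T = a ^ k • T := by
  induction k with
  | zero => simp
  | succ k ih => rw [pow_succ, mul_smul, h, hcomm, ih, ← mul_zsmul, ← pow_succ']

/-- **Fermat step.** If `p • T = 0` (`p` prime) and `F • T = a • T`, then `F ^ p • T = F • T`:
`a ^ p ≡ a (mod p)`. [folklore] -/
theorem pow_prime_smul_eq_smul (hcomm : ∀ (g : Γ) (m : ℤ) (X : A), g • (m • X) = m • (g • X))
    {p : ℕ} [hp : Fact p.Prime] {F : Γ} {T : A} (hT : (p : ℤ) • T = 0) {a : ℤ}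
    (h : F • T = a • T) : F ^ p • T = F • T := by
  rw [pow_smul_eq_pow_zsmul hcomm h, h]
  have hdvd : (p : ℤ) ∣ a ^ p - a := by
    rw [← ZMod.intCast_zmod_eq_zero_iff_dvd]
    push_cast
    rw [ZMod.pow_card, sub_self]
  obtain ⟨q, hq⟩ := hdvd
  have h0 : (a ^ p - a) • T = 0 := by rw [hq, mul_comm, mul_zsmul, hT, zsmul_zero]
  rw [sub_smul, sub_eq_zero] at h0
  exact h0

end Steps

/-! ## §2 `E[p](M) = E[p](K_v)` from `μ_p(M) = 1` -/

section RootsOfUnity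

variable {K : Type} [Field K] [CharZero K] (W : WeierstrassCurve K) [W.IsElliptic]
  (E : Type) [Field E] [Algebra K E]

/-- **`H`-fixed `p`-torsion is `Γ`-fixed when `H` fixes no primitive `p`-th root of unity.** Let
`E = W` be an elliptic curve over a field `K` of characteristic `0`, `E'` a `K`-field with absolute
Galois group `Γ`, `H ⊴ Γ` a normal subgroup with `Γ = ⋃ F^i H` and `F ^ p ∈ H`, `p` prime, such
that every `ζ ∈ K̄_{E'}` with `ζ ^ p = 1`, `ζ ≠ 1` is moved by some element of `H` (no primitive
`p`-th root of unity in the fixed field of `H`). Then every `p`-torsion point of `E(K̄_{E'})` fixed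
by `H` is fixed by all of `Γ`. (Weil pairing, Silverman *AEC* III.8.1, via the tree's
`exists_weilPairing_holds`; and `#E[p] = p²`, III.6.4.) [folklore] -/
theorem smul_eq_of_torsion_of_fixed_of_rootsOfUnity {p : ℕ} [hp : Fact p.Prime]
    (H : Subgroup (absoluteGaloisGroup E)) (hH : H.Normal) (F : absoluteGaloisGroup E)
    (hgen : ∀ σ : absoluteGaloisGroup E, ∃ (i : ℕ) (h : absoluteGaloisGroup E), h ∈ H ∧ σ = F ^ i * h)
    (hFp : F ^ p ∈ H)
    (hζ : ∀ ζ : AlgebraicClosure E, ζ ^ p = 1 → ζ ≠ 1 → ∃ h ∈ H, h • ζ ≠ ζ)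
    (T : localPoints W E) (hT : (p : ℤ) • T = 0) (hTH : ∀ h ∈ H, h • T = T)
    (σ : absoluteGaloisGroup E) : σ • T = T := by
  have hpr : p.Prime := hp.out
  have hn : (p : ℤ) ≠ 0 := by exact_mod_cast hpr.ne_zero
  have hcomm : ∀ (g : absoluteGaloisGroup E) (m : ℤ) (X : localPoints W E), g • (m • X) = m • (g • X) :=
    fun g m X ↦ W.smul_zsmul_localPoints m g X
  -- reduce to `F`
  by_contra hσ
  have hFT : F • T ≠ T := by
    intro hFT
    obtain ⟨i, h, hh, rfl⟩ := hgen σ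
    apply hσ
    rw [mul_smul, hTH h hh]
    clear hσ
    induction i with
    | zero => simp
    | succ i ih => rw [pow_succ, mul_smul, hFT, ih]
  have hT0 : T ≠ 0 := fun h0 ↦ hFT (by rw [h0, smul_zero])
  -- `D = F T − T`: non-zero, `p`-torsion, `H`-fixed
  set D : localPoints W E := F • T - T with hDdef
  have hD0 : D ≠ 0 := fun h0 ↦ hFT (sub_eq_zero.mp h0)
  have hDtors : (p : ℤ) • D = 0 := by
    rw [hDdef, zsmul_sub, ← hcomm, hT, smul_zero, sub_self]
  have hDH : ∀ h ∈ H, h • D = D := fun h hh ↦ smul_sub_eq_of_normal hH T hTH F hh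
  -- the `H`-fixed `p`-torsion as a subgroup `V` of the `p`-torsion `Tor`
  let Tor : AddSubgroup (localPoints W E) := AddSubgroup.torsionBy (localPoints W E) (p : ℤ)
  let V : AddSubgroup (localPoints W E) :=
    { carrier := {X | (p : ℤ) • X = 0 ∧ ∀ h ∈ H, h • X = X}
      zero_mem' := ⟨smul_zero _, fun h _ ↦ smul_zero h⟩
      add_mem' := fun {a b} ha hb ↦ ⟨by rw [smul_add, ha.1, hb.1, add_zero],
        fun h hh ↦ by rw [smul_add, ha.2 h hh, hb.2 h hh]⟩
      neg_mem' := fun {a} ha ↦ ⟨by rw [smul_neg, ha.1, neg_zero],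
        fun h hh ↦ by rw [smul_neg, ha.2 h hh]⟩ }
  have hVle : V ≤ Tor := fun X hX ↦ hX.1
  have hTV : T ∈ V := ⟨hT, hTH⟩
  have hDV : D ∈ V := ⟨hDtors, hDH⟩
  have hTorcard : Nat.card Tor = p ^ 2 := by
    rw [W.natCard_torsionBy_localPoints (E := E) (p : ℤ) hn, Int.natAbs_natCast]
  haveI : Finite Tor := Nat.finite_of_card_ne_zero (by rw [hTorcard]; exact pow_ne_zero _ hpr.ne_zero)
  -- case B: `D ∈ ℤ • T` is impossible (Fermat)
  have hDnot : ∀ c : ℤ, D ≠ c • T := by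
    intro c hc
    have hFa : F • T = (1 + c) • T := by
      rw [add_zsmul, one_zsmul, ← hc, hDdef, add_sub_cancel]
    have h1 := pow_prime_smul_eq_smul hcomm (p := p) hT hFa
    exact hFT (by rw [← h1, hTH _ hFp])
  -- case A: then `V = Tor`
  have hVcard : Nat.card V = p ^ 2 := by
    have hdvd : Nat.card V ∣ p ^ 2 := hTorcard ▸ AddSubgroup.card_dvd_of_le hVle
    obtain ⟨k, hk, hkV⟩ := (Nat.dvd_prime_pow hpr).mp hdvd
    interval_cases k
    · -- `#V = 1`: but `T ≠ 0`
      exfalso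
      rw [pow_zero] at hkV
      haveI := (Nat.card_eq_one_iff_unique.mp hkV).1
      exact hT0 (congrArg Subtype.val (Subsingleton.elim (⟨T, hTV⟩ : V) ⟨0, V.zero_mem⟩))
    · -- `#V = p`: cyclic generated by `T`, so `D ∈ ℤ • T`
      exfalso
      rw [pow_one] at hkV
      have hx : (⟨T, hTV⟩ : V) ≠ 0 := fun h0 ↦ hT0 (congrArg Subtype.val h0)
      obtain ⟨c, hc⟩ := (AddSubgroup.mem_zmultiples_iff).mp
        (mem_zmultiples_of_prime_card hkV hx (g' := (⟨D, hDV⟩ : V)))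
      exact hDnot c (by
        have := congrArg Subtype.val hc
        simpa using this.symm)
    · exact hkV
  have hVeq : V = Tor :=
    AddSubgroup.eq_of_le_of_card_ge hVle (by rw [hVcard, hTorcard])
  have hallfix : ∀ X : localPoints W E, (p : ℤ) • X = 0 → ∀ h ∈ H, h • X = X := by
    intro X hX
    have hXV : X ∈ V := by rw [hVeq]; exact hX
    exact hXV.2
  -- the Weil pairing gives an `H`-fixed primitive `p`-th root of unity
  haveI : PerfectField K := PerfectField.ofCharZero
  obtain ⟨e, hpow, haddl, haddr, halt, hnd, hgal⟩ :=
    W.exists_weilPairing_holds p hpr.two_le (by exact_mod_cast hpr.ne_zero)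
  -- some value `e S T₀ ≠ 1`
  obtain ⟨S, T₀, hST⟩ : ∃ S T₀ : geomTorsion W p, e S T₀ ≠ 1 := by
    by_contra hall
    push Not at hall
    have hsub : ∀ T₀ : geomTorsion W p, T₀ = 0 := fun T₀ ↦ hnd T₀ fun S ↦ hall S T₀
    have hcard1 : Nat.card (geomTorsion W p) = p ^ 2 := by
      have := W.natCard_geomTorsion (p : ℤ) hn
      rwa [Int.natAbs_natCast] at this
    haveI : Subsingleton (geomTorsion W p) := ⟨fun a b ↦ by rw [hsub a, hsub b]⟩
    have : Nat.card (geomTorsion W p) ≤ 1 := Finite.card_le_one_iff_subsingleton.mpr inferInstance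
    rw [hcard1] at this
    nlinarith [hpr.two_le]
  set ζ₀ : AlgebraicClosure K := e S T₀ with hζ₀
  -- `H` fixes `S` and `T₀` (read through the torsion comparison), hence `ζ₀`
  have hfixglob : ∀ (h : absoluteGaloisGroup E), h ∈ H → ∀ X : geomTorsion W p,
      resGal (K := K) E h • X = X := by
    intro h hh X
    apply (W.torsionPointsEquiv (p : ℤ) (E := E) hn).injective
    rw [W.torsionPointsEquiv_smul (p : ℤ) hn h X]
    apply Subtype.ext
    rw [Literature.NumberTheory.EllipticCurves.AddSubgroup.torsionBy.coe_smul]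
    exact hallfix _ (W.torsionPointsEquiv (p : ℤ) (E := E) hn X).2 h hh
  have hζ₀fix : ∀ h ∈ H, resGal (K := K) E h • ζ₀ = ζ₀ := fun h hh ↦ by
    rw [hζ₀, hgal, hfixglob h hh S, hfixglob h hh T₀]
  -- transport `ζ₀` to `K̄_{E'}` along the chosen embedding
  set ζ : AlgebraicClosure E := closureEmb (K := K) E ζ₀ with hζdef
  have hζp : ζ ^ p = 1 := by rw [hζdef, ← map_pow, hpow, map_one]
  have hζ1 : ζ ≠ 1 := fun h1 ↦ hST ((closureEmb (K := K) E).injective (by rw [map_one]; exact h1))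
  obtain ⟨h, hh, hmove⟩ := hζ ζ hζp hζ1
  apply hmove
  have hcomp := congrArg (fun f : AlgebraicClosure K →ₐ[K] AlgebraicClosure E ↦ f ζ₀)
    (comp_resGalAuxOfEmb (closureEmb (K := K) E) h)
  simp only [AlgHom.coe_comp, Function.comp_apply] at hcomp
  -- `h • ζ = h (closureEmb ζ₀) = closureEmb (resGal h ζ₀) = closureEmb ζ₀ = ζ`
  change (show AlgebraicClosure E ≃ₐ[E] AlgebraicClosure E from h) ζ = ζ
  rw [hζdef]
  have h2 : ((AlgEquiv.restrictScalars K (show AlgebraicClosure E ≃ₐ[E] AlgebraicClosure E from h) :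
      AlgebraicClosure E ≃ₐ[K] AlgebraicClosure E) : AlgebraicClosure E →ₐ[K] AlgebraicClosure E)
        (closureEmb (K := K) E ζ₀) = closureEmb (K := K) E ζ₀ := by
    rw [← hcomp]
    exact congrArg (closureEmb (K := K) E) (hζ₀fix h hh)
  exact h2

end RootsOfUnity

/-! ## §3 The certificate shape with every group-theoretic binder discharged -/

section Main

open NumberField IsDedekindDomain

variable {K : Type} [Field K] [NumberField K] (W W' : WeierstrassCurve K) [W.IsElliptic]
  [W'.IsElliptic] {p : ℕ} [Fact p.Prime]

/-- **Visibility with a twisted-divisible witness — the form the records use.** Let `p` be an odd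
prime, `θ : E'[p] ⥲ E[p]` a `Γ_K`-isomorphism, `S ⊇` bad places of `E`, `E'` and places above `p`,
`E(K)` finite of order prime to `p`, `P ∈ E'(K) ∖ pE'(K)`, `v₀ ∈ S`. Off `v₀`: criterion (a) (a
`p`-th root of `P` in `E'(K_v)`) or (c) (`ι_v(θ) = 1`, the tree's free kinds). At `v₀`, with
`Γ = Γ_{K_{v₀}}`: a normal subgroup `H ⊴ Γ` of index `p` and `F ∉ H` (`M = K̄_{v₀}^H` cyclic of
degree `p` over `K_{v₀}`); NO primitive `p`-th root of unity of `K̄_{v₀}` is fixed by `H`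
(`μ_p(M) = 1`); `#E(K_{v₀})[p] = p` (Mathlib's `K_{v₀}`-points); (d1) an `H`-fixed `Q' ∈ E'(K̄_{v₀})`
with `p • Q' = P`; (d2) an `H`-fixed `Q₁ ∈ E(K̄_{v₀})` with `p • Q₁ ∈ E(K_{v₀})` and `F • Q₁ ≠ Q₁`.
**Then `Ш(E/K)` has a non-zero element killed by `p`.** Over `ℚ` at `p = 3`, `v₀ = 3`,
`M = ℚ₃(α)`, `α³ = α + 1` (unramified cubic; `ζ₃ ∉ M`): the unramified-cubic witness road (note
THEOREM C). [folklore] -/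
theorem exists_sha_ne_zero_of_congr_of_twistedDivisible_of_rootsOfUnity (hp2 : p ≠ 2)
    (θ : geomTorsion W' (p : ℤ) ≃+ geomTorsion W (p : ℤ))
    (hθ : ∀ (σ : absoluteGaloisGroup K) (P : geomTorsion W' (p : ℤ)), θ (σ • P) = σ • θ P)
    (S : Finset (HeightOneSpectrum (𝓞 K)))
    (hS : ∀ v : HeightOneSpectrum (𝓞 K), v ∉ S →
      W.HasGoodReductionAt v ∧ W'.HasGoodReductionAt v ∧ (p : 𝓞 K) ∉ v.asIdeal)
    (hfin : Finite W.toAffine.Point) (hcop : (Nat.card W.toAffine.Point).Coprime p)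
    (P : W'.toAffine.Point)
    (hP : P ∉ (zsmulAddGroupHom (p : ℤ) : W'.toAffine.Point →+ W'.toAffine.Point).range)
    (v₀ : HeightOneSpectrum (𝓞 K))
    (hoff : ∀ v ∈ S, v ≠ v₀ →
      (∃ Q : (W'.baseChange (v.adicCompletion K)).toAffine.Point,
        p • Q = WeierstrassCurve.Affine.Point.baseChange (W' := W') K (v.adicCompletion K) P) ∨
      (selmerLocalKer W (v.adicCompletion K) (p : ℤ)).relIndex
        ((selmerLocalKer W' (v.adicCompletion K) (p : ℤ)).map (h1Equiv θ hθ).toAddMonoidHom) = 1)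
    (H : Subgroup (absoluteGaloisGroup (v₀.adicCompletion K))) (hH : H.Normal) (hind : H.index = p)
    (F : absoluteGaloisGroup (v₀.adicCompletion K)) (hF : F ∉ H)
    (hζ : ∀ ζ : AlgebraicClosure (v₀.adicCompletion K), ζ ^ p = 1 → ζ ≠ 1 → ∃ h ∈ H, h • ζ ≠ ζ)
    (hcard : Nat.card (nsmulAddMonoidHom p :
      (W.baseChange (v₀.adicCompletion K)).toAffine.Point →+ _).ker = p)
    (Q' : localPoints W' (v₀.adicCompletion K)) (hQ'H : ∀ h ∈ H, h • Q' = Q')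
    (hQ' : (p : ℤ) • Q' = pointsMap W' (v₀.adicCompletion K) (toGeomPoints W' P))
    (Q₁ : localPoints W (v₀.adicCompletion K)) (hQ₁H : ∀ h ∈ H, h • Q₁ = Q₁)
    (hQ₁ : (p : ℤ) • Q₁ ∈ MulAction.fixedPoints (absoluteGaloisGroup (v₀.adicCompletion K))
      (localPoints W (v₀.adicCompletion K)))
    (hQ₁F : F • Q₁ ≠ Q₁) :
    ∃ c : W.sha, c ≠ 0 ∧ p • c = 0 := by
  haveI : CharZero (v₀.adicCompletion K) := charZero_adicCompletion v₀
  haveI : H.Normal := hH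
  have hgen := exists_pow_mul_of_index_eq_prime H hind hF
  have hFp : F ^ p ∈ H := by rw [← hind]; exact Subgroup.pow_index_mem H F
  exact exists_sha_ne_zero_of_congr_of_twistedDivisible_of_card W W' hp2 θ hθ S hS hfin hcop P hP v₀
    hoff H hH hind F hF
    (smul_eq_of_torsion_of_fixed_of_rootsOfUnity W (v₀.adicCompletion K) H hH F hgen hFp hζ)
    (smul_eq_of_torsion_of_fixed_of_rootsOfUnity W' (v₀.adicCompletion K) H hH F hgen hFp hζ)
    hcard Q' hQ'H hQ' Q₁ hQ₁H hQ₁ hQ₁F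

end Main

end Summit.BirchSwinnertonDyer.Rank1Residual.GaloisImage.TwistedWitness

end
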